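import Summits.CriticalPhenomena.PercolationContinuityZ3.Theorems.PercNearOneGluingNoHeavyLowerTailMajorityGluingQCertSym3Parts
import Summits.CriticalPhenomena.PercolationContinuityZ3.Theorems.PercNearOneGluingNoHeavyLowerTailMajorityGluingZFourteenEightH
import Summits.CriticalPhenomena.PercolationContinuityZ3.Theorems.PercNearOneGluingNoHeavyLowerTailMajorityGluingEightHarris
import HarnessLib

/-!
# Eight of fourteen relays cut from the hub: `μ ≤ (3/2)·max_i μ(vᵢ ↮ a₀)` by a kernel-checked ORBIT certificate; `C(16), C(17) ≤ 5/2`, `= 2` for `max ≥ 1/3` (lane prim-rate, constants-miner 1, gen 39; CANDIDATES §GEN-39)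

Support file for the closed crux `NoHeavyLowerTail` (stmt-CriticalPhenomena-4575), majority-gluing line.  The ROOT CELL `R_8 = (14,8)` of the window (it closes
`|A| = 16` and, by the cell monotonicity `cutCount_mono`, `|A| = 17`) gets a kernel-checked symmetrised Positivstellensatz certificate `QCert.fourteenEightT2` (kit j310356: ENGINE T symlpt.py — the S_m-SYMMETRISED DEGREE-3 moment LP written ENTIRELY IN TYPE SPACE over the checker's cubic orbit keys (constraint vectors = the checker's own count-vector tables); cutting-plane pool of j307588 (24 000 row×lift / square×lift orbits: lift families t ∈ {δ, all, |t| = 8, 7} + random lifts); exact integer multipliers from the phase-3 certificate LP over that pool (margin 1.0 at c = 3/2 exactly), re-verified in type space by cert/mksym3z.py (21 323 orbit keys, all sums ≥ 0); ONE representative per relabelling orbit; the kernel evaluation is split into 73 SPEC-ONLY Z parts (`…MajorityGluingZFourteenEightP*`) glued HIERARCHICALLY (7 groups × 6 key ranges: `…ZFourteenEightHG*`, `…HG*C*`, `…HR*`, top `…MajorityGluingZFourteenEightH`)):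
**`eightOfFourteen_fourteenEightT2` : `μ(8 ≤ #{v ∈ T : v ↮ a₀}) ≤ (3/2)·δ`** for every finite weighted graph, hub `a₀`, `14`-set `T` and `δ ≥` the cut probabilities (an instance of the
generic `QCert.SymCert3.cut_of_posS3_count`).  Consequences via `cutCount_mono` and the generic Harris layer of `…MajorityGluingEightHarris`:
**`majorityGluing_card_sixteen_seventeen_fourteenEightT2` : `C(16), C(17) ≤ 5/2`** (tree: 11/4 = 1 + 14/8 (k = 16) and 8/3 = 1 + 15/9 (k = 17) by the first-moment (Markov) cell bound; the first certificate beyond k = 15),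
**`majorityGluing_two_card_sixteen_seventeen_of_ge_fourteenEightT2` : `C(16) = C(17) = 2` whenever `max ≥ 1/3`**, and the Harris form `δ₀ + (3/2)δ₀(1 − δ₀)`.  No sorries.
[cite: VandenbergKahn2001, Thm 1.2 (p. 123)] [cite: KozmaNitzan2024, Conj. 1 (p. 3), Conj. 4 (p. 32)]
-/

noncomputable section

namespace Summit.CriticalPhenomena.PercolationContinuityZ3.Theorems

open MeasureTheory Set
open Literature.Probability.LatticeModels (prodBernoulli)
open Literature.Probability.Percolation
open scoped Classical

namespace HubOnly

variable {n : ℕ}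

/-- **AT LEAST EIGHT OF FOURTEEN RELAYS CUT: `μ ≤ (3/2)·δ`** for every finite weighted graph, hub `a₀`, `14`-set `T` and `δ` bounding the cut probabilities — the
kernel-checked certificate `QCert.fourteenEightT2`. [cite: VandenbergKahn2001, Thm 1.2 (p. 123)] -/
theorem eightOfFourteen_fourteenEightT2 (w : Sym2 (Fin n) → unitInterval) (a₀ : Fin n) (T : Finset (Fin n)) (hT : T.card = 14) (δ : ℝ)
    (hδ : ∀ v ∈ T, (prodBernoulli w).real (openConn v a₀ : Set (BondConfig (Fin n)))ᶜ ≤ δ) :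
    (prodBernoulli w).real {ω : BondConfig (Fin n) | 8 ≤ (T.filter fun v => ω ∉ openConn v a₀).card} ≤ 3 / 2 * δ := by
  obtain ⟨v, hv⟩ : T.Nonempty := by rw [← Finset.card_pos, hT]; norm_num
  have hδ0 : 0 ≤ δ := le_trans measureReal_nonneg (hδ v hv)
  have h := QCert.SymCert3.cut_of_posS3_count QCert.fourteenEightT2 QCert.fourteenEightT2_m QCert.fourteenEightT2_checkWS QCert.fourteenEightT2_pos w a₀ T hT δ hδ0 hδ
  rw [QCert.fourteenEightT2_base] at h
  have hcD : (QCert.fourteenEightT2Base.cD : ℝ) = 2 := by norm_num [QCert.fourteenEightT2Base]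
  have hcN : (QCert.fourteenEightT2Base.cN : ℝ) = 3 := by norm_num [QCert.fourteenEightT2Base]
  have hh : QCert.fourteenEightT2Base.h = 8 := rfl
  rw [hcD, hcN, hh] at h
  linarith

/-- The cell(s) of `|A| ∈ {16, 17}` obey the constant bound `(3/2)·δ` (via the cell monotonicity `cutCount_mono`). [cite: VandenbergKahn2001, Thm 1.2 (p. 123)] -/
theorem cell_sixteen_seventeen_fourteenEightT2 (p : Sym2 (Fin n) → unitInterval) (A : Finset (Fin n)) (a₀ : Fin n) (hA1 : 16 ≤ A.card) (hA2 : A.card ≤ 17)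
    (T : Finset (Fin n)) (δ : ℝ) (haT : a₀ ∉ T) (_hTA : T ⊆ A) (hTcard : T.card + 2 = A.card) (_hδ : 0 ≤ δ)
    (hδT : ∀ v ∈ T, (prodBernoulli p).real (openConn v a₀ : Set (BondConfig (Fin n)))ᶜ ≤ δ) :
    (prodBernoulli p).real {ω : BondConfig (Fin n) | (A.card + 1) / 2 ≤ (T.filter fun v => ω ∉ openConn v a₀).card} ≤ 3 / 2 * δ :=
  cutCount_mono p a₀ 14 8 δ (3 / 2 * δ) (fun T₀ hT₀ _ hδT₀ => eightOfFourteen_fourteenEightT2 p a₀ T₀ hT₀ δ hδT₀) T ((A.card + 1) / 2)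
    (by omega) (by omega) haT hδT

/-- **MAJORITY GLUING AT `|A| ∈ {16, 17}` WITH LOSS `(5/2)·max`:** `μ(o ↔ A) − (5/2)δ₀ ≤ μ(o ↔ a₀ ∧ 2N > |A|)` for every weight function, observer,
hub `a₀ ∈ A`, `|A| ∈ {16, 17}`, `δ₀ ≥ max_{a∈A} μ(a ↮ a₀)`. [cite: VandenbergKahn2001, Thm 1.2 (p. 123)] [cite: KozmaNitzan2024, Conj. 1 (p. 3)] -/
theorem majorityGluing_card_sixteen_seventeen_fourteenEightT2 (w : Sym2 (Fin n) → unitInterval) (A : Finset (Fin n)) (o a₀ : Fin n) (δ₀ : ℝ)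
    (ha₀ : a₀ ∈ A) (hA1 : 16 ≤ A.card) (hA2 : A.card ≤ 17)
    (hδ₀ : ∀ a ∈ A, (prodBernoulli w).real (openConn a a₀ : Set (BondConfig (Fin n)))ᶜ ≤ δ₀) :
    (prodBernoulli w).real (⋃ a ∈ A, openConn o a) - 5 / 2 * δ₀ ≤
      (prodBernoulli w).real {ω : BondConfig (Fin n) | ω ∈ openConn o a₀ ∧
          A.card < 2 * (A.filter fun a => ω ∈ openConn o a).card} := by
  have h := majorityGluing_of_cellConst w A o a₀ δ₀ ha₀ (by omega) (3 / 2) (by norm_num)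
    (fun p _ T δ haT hTA hTcard hδ hδT => cell_sixteen_seventeen_fourteenEightT2 p A a₀ hA1 hA2 T δ haT hTA hTcard hδ hδT) hδ₀
  norm_num at h ⊢
  linarith

/-- **MAJORITY GLUING AT `|A| ∈ {16, 17}`, HARRIS FORM:** loss `δ₀ + (3/2)·δ₀·(1 − δ₀)` for `max_{a∈A} μ(a ↮ a₀) ≤ δ₀ ≤ 2/3`.
[cite: VandenbergKahn2001, Thm 1.2 (p. 123)] [cite: KozmaNitzan2024, Conj. 1 (p. 3)] -/
theorem majorityGluing_harris_card_sixteen_seventeen_fourteenEightT2 (w : Sym2 (Fin n) → unitInterval) (A : Finset (Fin n)) (o a₀ : Fin n) (δ₀ : ℝ)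
    (ha₀ : a₀ ∈ A) (hA1 : 16 ≤ A.card) (hA2 : A.card ≤ 17)
    (hδ₀ : ∀ a ∈ A, (prodBernoulli w).real (openConn a a₀ : Set (BondConfig (Fin n)))ᶜ ≤ δ₀) (hδ₀' : δ₀ ≤ 2 / 3) :
    (prodBernoulli w).real (⋃ a ∈ A, openConn o a) -
        (prodBernoulli w).real {ω : BondConfig (Fin n) | ω ∈ openConn o a₀ ∧
          A.card < 2 * (A.filter fun a => ω ∈ openConn o a).card}
      ≤ δ₀ + 3 / 2 * δ₀ * (1 - δ₀) :=
  majorityGluing_harris_of_cellConst w A o a₀ δ₀ ha₀ (by omega) (3 / 2) (by norm_num)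
    (fun p _ T δ haT hTA hTcard hδ hδT => cell_sixteen_seventeen_fourteenEightT2 p A a₀ hA1 hA2 T δ haT hTA hTcard hδ hδT) hδ₀ (by linarith)

/-- **`C(16) = C(17) = 2` WHENEVER `max ≥ 1/3`:** `μ(o ↔ A) − 2δ₀ ≤ μ(o ↔ a₀ ∧ 2N > |A|)` for `|A| ∈ {16, 17}`, `δ₀ ≥ max_{a∈A} μ(a ↮ a₀)`, `δ₀ ≥ 1/3`.
[cite: VandenbergKahn2001, Thm 1.2 (p. 123)] [cite: KozmaNitzan2024, Conj. 1 (p. 3), Conj. 4 (p. 32)] -/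
theorem majorityGluing_two_card_sixteen_seventeen_of_ge_fourteenEightT2 (w : Sym2 (Fin n) → unitInterval) (A : Finset (Fin n)) (o a₀ : Fin n) (δ₀ : ℝ)
    (ha₀ : a₀ ∈ A) (hA1 : 16 ≤ A.card) (hA2 : A.card ≤ 17)
    (hδ₀ : ∀ a ∈ A, (prodBernoulli w).real (openConn a a₀ : Set (BondConfig (Fin n)))ᶜ ≤ δ₀) (hreg : 1 / 3 ≤ δ₀) :
    (prodBernoulli w).real (⋃ a ∈ A, openConn o a) - 2 * δ₀ ≤
      (prodBernoulli w).real {ω : BondConfig (Fin n) | ω ∈ openConn o a₀ ∧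
          A.card < 2 * (A.filter fun a => ω ∈ openConn o a).card} :=
  majorityGluing_two_of_cellConst w A o a₀ δ₀ ha₀ (by omega) (3 / 2) (by norm_num)
    (fun p _ T δ haT hTA hTcard hδ hδT => cell_sixteen_seventeen_fourteenEightT2 p A a₀ hA1 hA2 T δ haT hTA hTcard hδ hδT) hδ₀ (by linarith)

end HubOnly

end Summit.CriticalPhenomena.PercolationContinuityZ3.Theorems

end
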